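import Summits.QuantumFields.YangMills.Theorems.FlatTubeReductionTransportStepSecondDifference
import HarnessLib

/-!
# Near-pair DIFFERENCES of the transported kinetic step between two slow data `constLift u`, `constLift u'`: the anharmonic remainder of `X_p(W; constLift u)` minus that of
# `X_p(W; constLift u')` is `O(α·τ²)` with `α` the size of the relative rotations `u_k u'_k⁻¹` — not `O((τ_u + τ_u')·τ²)`
# (route `FlatTubeReduction`, crux K1 `NearFlatRatioLaw` stmt-QuantumFields-24720; seat `ym-line-ftr-p1` g16; rate twin «ratepack-v3/v4»; R2b1 RECORD rung — no summit statement
# is proved here)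

WHY (NOTES g16 §NP-L; memo `Cruxes/NearFlatRatioLaw/Lines/ratepack-v4-moments-g15.md` §2).  The near-pair rate `η_s` of the dressed (B-T) comparison (`…SymmetricCorePair`) contains lane A's
magnetic remainder `2·stepActionErr t σ ∋ 2·N_P·1728·t²√σ` — the cubic remainder of the Wilson action on the tube at the slow datum `u` AND at `u'`, bounded SEPARATELY.  With `βt² = 1`
this is `≍ δ² ≍ λ_b`, so `η_s² ≍ λ_b²` exactly: the profile radius `t` is pinned to `β^{-1/2}` with no room, while the (B-OD)-rate brick needs a truncated Gaussian profile of radius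
`β^{-1/2}√(C log β)`.  In truth the remainder enters `offX(u,u')` as a DIFFERENCE `R(v'; u') − R(v'; u)`, which is `O(α·t²)` for a near pair (`‖vecPart(u_ku'_k⁻¹)‖_∞ ≤ α`,
`α ≍ β^{-1/2}√log β`).  This file is the quaternion bookkeeping: the pair version of `…TransportStepSecondDifference.transportStep_constLift_second_diff`, with the transports of
`constLift u'` in place of those of the vacuum.
* §1 ★ `abs_adRot_pair_mulVec_le` — `|(Ad(a)y − Ad(a')y)_c| ≤ 36·α·ρ` when `|vecPart(a a'⁻¹)|_∞ ≤ α ≤ 1`, `|y|_∞ ≤ ρ`; `abs_vecPart_inv_mul_le` — `|vecPart(a⁻¹a')|_∞ ≤ 3α`.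
* §2 ★ `transports_constLift_pair_displacement` — the three transports `u_i`, `u_iu_ju_i⁻¹`, `u_iu_ju_i⁻¹u_j⁻¹` of `constLift u` versus those of `constLift u'` move a vector with
  `|w|_∞ ≤ τ` by at most `36·α·τ`, `1404·α·τ`, `6264·α·τ` per component (`α ≤ 1/3`).
* §3 ★★ `transportStep_constLift_pair_diff` — componentwise `|[vecPart X_p(W;cL u) − (D_u w)_p] − [vecPart X_p(W;cL u') − (D_{u'} w)_p]| ≤ 995976·α·τ²`,
  `|u₀X_p(W;cL u) − u₀X_p(W;cL u')| ≤ 1014768·α·τ²`, `|(D_u w)_p − (D_{u'} w)_p| ≤ 7704·α·τ` (`cL = constLift`, `|w_{e,c}| ≤ τ ≤ 1/30`).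
HONEST FRAMING: quaternion algebra (componentwise real inequalities on top of the landed `prod4_second_diff`); femto rung R2b1 (RECORD label); not infinite volume, not a gap, not Clay.
No defs, no named facts, no `sorry`.
-/

set_option autoImplicit false

noncomputable section

open scoped Matrix BigOperators
open Literature.MathematicalPhysics.QuantumFieldTheory
open Literature.MathematicalPhysics.QuantumLattice

namespace Summit.QuantumFields.YangMills.Theorems.FemtoTransferGap.RateTube

open Summit.QuantumFields.YangMills.Theorems.FemtoTransferGap
open Summit.QuantumFields.YangMills.Theorems.FemtoTransferGap.TwoLattice
open Summit.QuantumFields.YangMills.Theorems.FemtoTransferGap.TwoLattice.Stiff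
open Summit.QuantumFields.YangMills.Theorems.FemtoTransferGap.TwoLattice.Cov
open Summit.QuantumFields.YangMills.Theorems.FemtoTransferGap.TwoLattice.ConstTube
open Summit.QuantumFields.YangMills.Theorems.FemtoTransferGap.TwoLattice.Toron

variable {L : ℕ} [NeZero L]

/-! ## §1 ★ One rotation versus another -/

omit [NeZero L] in
/-- ★ **Two rotations, one vector**: if `|vecPart(a·a'⁻¹)_b| ≤ α ≤ 1` and `|y_b| ≤ ρ` then `|(Ad(a)y − Ad(a')y)_c| ≤ 36·α·ρ` (`Ad(a) = Ad(aa'⁻¹)Ad(a')` and the first-order size of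
one rotation, `abs_adRot_mulVec_sub_le`). [cite: BrockerTomDieck1985, I (1.10)] -/
theorem abs_adRot_pair_mulVec_le {a a' : SU2} {α ρ : ℝ} (hα : ∀ b, |vecPart (a * a'⁻¹) b| ≤ α) (hα1 : α ≤ 1) {y : Fin 3 → ℝ} (hy : ∀ b, |y b| ≤ ρ) (c : Fin 3) :
    |(adRot a *ᵥ y - adRot a' *ᵥ y) c| ≤ 36 * α * ρ := by
  have hα0 : 0 ≤ α := (abs_nonneg _).trans (hα 0)
  have hρ0 : 0 ≤ ρ := (abs_nonneg _).trans (hy 0)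
  have e : adRot a *ᵥ y = adRot (a * a'⁻¹) *ᵥ (adRot a' *ᵥ y) := by
    rw [Matrix.mulVec_mulVec, ← adRot_mul, inv_mul_cancel_right]
  have hz : ∀ b, |(adRot a' *ᵥ y) b| ≤ 3 * ρ := fun b => abs_adRot_mulVec_le a' hy b
  have h := abs_adRot_mulVec_sub_le hα hz c
  rw [e]
  refine h.trans ?_
  have hα2 : α ^ 2 ≤ α := by nlinarith
  nlinarith [mul_le_mul_of_nonneg_right hα2 hρ0]

omit [NeZero L] in
/-- The relative rotation seen from the other side: `|vecPart(a⁻¹·a')_b| ≤ 3α` when `|vecPart(a·a'⁻¹)|_∞ ≤ α` (`a⁻¹a' = a⁻¹(aa'⁻¹)⁻¹a` is a conjugate of the inverse).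
[cite: BrockerTomDieck1985, I (1.10)] -/
theorem abs_vecPart_inv_mul_le {a a' : SU2} {α : ℝ} (hα : ∀ b, |vecPart (a * a'⁻¹) b| ≤ α) (b : Fin 3) : |vecPart (a⁻¹ * a') b| ≤ 3 * α := by
  have e : a⁻¹ * a' = a⁻¹ * (a * a'⁻¹)⁻¹ * (a⁻¹)⁻¹ := by group
  have hneg : ∀ b', |(-vecPart (a * a'⁻¹)) b'| ≤ α := fun b' => by rw [Pi.neg_apply, abs_neg]; exact hα b'
  rw [e, vecPart_conj, vecPart_inv]
  exact abs_adRot_mulVec_le _ hneg b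

omit [NeZero L] in
/-- One more rotation on top of a componentwise difference: `|(Ad(a)y − Ad(a')y')_c| ≤ 36αρ + 3ε` when `|vecPart(aa'⁻¹)|_∞ ≤ α ≤ 1`, `|y|_∞ ≤ ρ`, `|y − y'|_∞ ≤ ε`. [folklore] -/
theorem abs_adRot_pair_mulVec_pair_le {a a' : SU2} {α ρ ε : ℝ} (hα : ∀ b, |vecPart (a * a'⁻¹) b| ≤ α) (hα1 : α ≤ 1) {y y' : Fin 3 → ℝ} (hy : ∀ b, |y b| ≤ ρ)
    (hyy : ∀ b, |(y - y') b| ≤ ε) (c : Fin 3) :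
    |(adRot a *ᵥ y - adRot a' *ᵥ y') c| ≤ 36 * α * ρ + 3 * ε := by
  have h1 := abs_adRot_pair_mulVec_le hα hα1 hy c
  have h2 : |(adRot a' *ᵥ (y - y')) c| ≤ 3 * ε := abs_adRot_mulVec_le a' hyy c
  have e : (adRot a *ᵥ y - adRot a' *ᵥ y') c = (adRot a *ᵥ y - adRot a' *ᵥ y) c + (adRot a' *ᵥ (y - y')) c := by
    simp only [Pi.sub_apply, Matrix.mulVec_sub]; ring
  rw [e]
  exact (abs_add_le _ _).trans (add_le_add h1 h2)

/-! ## §2 ★ The three transports of `constLift u` versus those of `constLift u'` -/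

omit [NeZero L] in
/-- ★ **Pair displacement of the transports.**  If `|vecPart(u_k u'_k⁻¹)_c| ≤ α ≤ 1/3` for all `k` and `|w_b| ≤ τ`, then for `P(u) ∈ {u_i, u_iu_ju_i⁻¹, u_iu_ju_i⁻¹u_j⁻¹}`:
`|(Ad(P(u))w − Ad(P(u'))w)_c| ≤ 36·α·τ`, `1404·α·τ`, `6264·α·τ` respectively (telescoping through the factors; inverse factors cost `3α`). [cite: BrockerTomDieck1985, I (1.10)] -/
theorem transports_constLift_pair_displacement (u u' : GaugeConfig 3 1 SU2) {α : ℝ} (hα3 : α ≤ 1 / 3)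
    (ha : ∀ (k : Fin 3) (c : Fin 3), |vecPart (u (0, k) * (u' (0, k))⁻¹) c| ≤ α)
    (i j : Fin 3) {w : Fin 3 → ℝ} {τ : ℝ} (hw : ∀ b, |w b| ≤ τ) (c : Fin 3) :
    |(adRot (u (0, i)) *ᵥ w - adRot (u' (0, i)) *ᵥ w) c| ≤ 36 * α * τ ∧
      |(adRot (u (0, i) * u (0, j) * (u (0, i))⁻¹) *ᵥ w - adRot (u' (0, i) * u' (0, j) * (u' (0, i))⁻¹) *ᵥ w) c| ≤ 1404 * α * τ ∧
      |(adRot (u (0, i) * u (0, j) * (u (0, i))⁻¹ * (u (0, j))⁻¹) *ᵥ w - adRot (u' (0, i) * u' (0, j) * (u' (0, i))⁻¹ * (u' (0, j))⁻¹) *ᵥ w) c| ≤ 6264 * α * τ := by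
  have hα0 : 0 ≤ α := (abs_nonneg _).trans (ha 0 0)
  have hτ0 : 0 ≤ τ := (abs_nonneg _).trans (hw 0)
  have hα1 : α ≤ 1 := by linarith
  have h3α1 : 3 * α ≤ 1 := by linarith
  have hατ : 0 ≤ α * τ := mul_nonneg hα0 hτ0
  -- relative rotations of the inverse factors
  have hinv : ∀ k b, |vecPart ((u (0, k))⁻¹ * ((u' (0, k))⁻¹)⁻¹) b| ≤ 3 * α := fun k b => by
    rw [inv_inv]; exact abs_vecPart_inv_mul_le (ha k) b
  -- sizes: a single rotation of `w` has components `≤ 3τ`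
  have hrot : ∀ (P : SU2) (b : Fin 3), |(adRot P *ᵥ w) b| ≤ 3 * τ := fun P b => abs_adRot_mulVec_le P hw b
  -- (T1) `u_i` versus `u'_i`
  have T1 : ∀ c, |(adRot (u (0, i)) *ᵥ w - adRot (u' (0, i)) *ᵥ w) c| ≤ 36 * α * τ := fun c => abs_adRot_pair_mulVec_le (ha i) hα1 hw c
  -- (T2) `u_iu_ju_i⁻¹`: peel `u_i`, then `u_j`, then `u_i⁻¹`
  have T2 : ∀ c, |(adRot (u (0, i) * u (0, j) * (u (0, i))⁻¹) *ᵥ w - adRot (u' (0, i) * u' (0, j) * (u' (0, i))⁻¹) *ᵥ w) c| ≤ 1404 * α * τ := by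
    intro c
    -- innermost: `u_i⁻¹`
    have s1 : ∀ b, |(adRot ((u (0, i))⁻¹) *ᵥ w - adRot ((u' (0, i))⁻¹) *ᵥ w) b| ≤ 36 * (3 * α) * τ := fun b =>
      abs_adRot_pair_mulVec_le (hinv i) h3α1 hw b
    -- middle: `u_j`
    have s2 : ∀ b, |(adRot (u (0, j)) *ᵥ (adRot ((u (0, i))⁻¹) *ᵥ w) - adRot (u' (0, j)) *ᵥ (adRot ((u' (0, i))⁻¹) *ᵥ w)) b| ≤ 36 * α * (3 * τ) + 3 * (36 * (3 * α) * τ) :=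
      fun b => abs_adRot_pair_mulVec_pair_le (ha j) hα1 (hrot _) s1 b
    -- the middle vector is a single rotation of `w`
    have hmid : ∀ b, |(adRot (u (0, j)) *ᵥ (adRot ((u (0, i))⁻¹) *ᵥ w)) b| ≤ 3 * τ := fun b => by
      rw [Matrix.mulVec_mulVec, ← adRot_mul]; exact hrot _ b
    have s3 := abs_adRot_pair_mulVec_pair_le (ha i) hα1 hmid s2 c
    have e : adRot (u (0, i) * u (0, j) * (u (0, i))⁻¹) *ᵥ w = adRot (u (0, i)) *ᵥ (adRot (u (0, j)) *ᵥ (adRot ((u (0, i))⁻¹) *ᵥ w)) := by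
      rw [Matrix.mulVec_mulVec, Matrix.mulVec_mulVec, ← adRot_mul, ← adRot_mul]
    have e' : adRot (u' (0, i) * u' (0, j) * (u' (0, i))⁻¹) *ᵥ w = adRot (u' (0, i)) *ᵥ (adRot (u' (0, j)) *ᵥ (adRot ((u' (0, i))⁻¹) *ᵥ w)) := by
      rw [Matrix.mulVec_mulVec, Matrix.mulVec_mulVec, ← adRot_mul, ← adRot_mul]
    rw [e, e']
    refine s3.trans ?_
    nlinarith
  -- (T3) the commutator: peel `u_i`, `u_j`, `u_i⁻¹`, `u_j⁻¹`
  have T3 : ∀ c, |(adRot (u (0, i) * u (0, j) * (u (0, i))⁻¹ * (u (0, j))⁻¹) *ᵥ w -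
      adRot (u' (0, i) * u' (0, j) * (u' (0, i))⁻¹ * (u' (0, j))⁻¹) *ᵥ w) c| ≤ 6264 * α * τ := by
    intro c
    have s1 : ∀ b, |(adRot ((u (0, j))⁻¹) *ᵥ w - adRot ((u' (0, j))⁻¹) *ᵥ w) b| ≤ 36 * (3 * α) * τ := fun b =>
      abs_adRot_pair_mulVec_le (hinv j) h3α1 hw b
    have s2 : ∀ b, |(adRot ((u (0, i))⁻¹) *ᵥ (adRot ((u (0, j))⁻¹) *ᵥ w) - adRot ((u' (0, i))⁻¹) *ᵥ (adRot ((u' (0, j))⁻¹) *ᵥ w)) b| ≤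
        36 * (3 * α) * (3 * τ) + 3 * (36 * (3 * α) * τ) := fun b => abs_adRot_pair_mulVec_pair_le (hinv i) h3α1 (hrot _) s1 b
    have hm2 : ∀ b, |(adRot ((u (0, i))⁻¹) *ᵥ (adRot ((u (0, j))⁻¹) *ᵥ w)) b| ≤ 3 * τ := fun b => by
      rw [Matrix.mulVec_mulVec, ← adRot_mul]; exact hrot _ b
    have s3 : ∀ b, |(adRot (u (0, j)) *ᵥ (adRot ((u (0, i))⁻¹) *ᵥ (adRot ((u (0, j))⁻¹) *ᵥ w)) -
        adRot (u' (0, j)) *ᵥ (adRot ((u' (0, i))⁻¹) *ᵥ (adRot ((u' (0, j))⁻¹) *ᵥ w))) b| ≤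
        36 * α * (3 * τ) + 3 * (36 * (3 * α) * (3 * τ) + 3 * (36 * (3 * α) * τ)) := fun b => abs_adRot_pair_mulVec_pair_le (ha j) hα1 hm2 s2 b
    have hm3 : ∀ b, |(adRot (u (0, j)) *ᵥ (adRot ((u (0, i))⁻¹) *ᵥ (adRot ((u (0, j))⁻¹) *ᵥ w))) b| ≤ 3 * τ := fun b => by
      rw [Matrix.mulVec_mulVec, Matrix.mulVec_mulVec, ← adRot_mul, ← adRot_mul]; exact hrot _ b
    have s4 := abs_adRot_pair_mulVec_pair_le (ha i) hα1 hm3 s3 c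
    have e : adRot (u (0, i) * u (0, j) * (u (0, i))⁻¹ * (u (0, j))⁻¹) *ᵥ w =
        adRot (u (0, i)) *ᵥ (adRot (u (0, j)) *ᵥ (adRot ((u (0, i))⁻¹) *ᵥ (adRot ((u (0, j))⁻¹) *ᵥ w))) := by
      rw [Matrix.mulVec_mulVec, Matrix.mulVec_mulVec, Matrix.mulVec_mulVec, ← adRot_mul, ← adRot_mul, ← adRot_mul]
    have e' : adRot (u' (0, i) * u' (0, j) * (u' (0, i))⁻¹ * (u' (0, j))⁻¹) *ᵥ w =
        adRot (u' (0, i)) *ᵥ (adRot (u' (0, j)) *ᵥ (adRot ((u' (0, i))⁻¹) *ᵥ (adRot ((u' (0, j))⁻¹) *ᵥ w))) := by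
      rw [Matrix.mulVec_mulVec, Matrix.mulVec_mulVec, Matrix.mulVec_mulVec, ← adRot_mul, ← adRot_mul, ← adRot_mul]
    rw [e, e']
    refine s4.trans ?_
    nlinarith
  exact ⟨T1 c, T2 c, T3 c⟩

/-! ## §3 ★★ The transported step at `constLift u` versus `constLift u'` -/

set_option maxHeartbeats 800000 in
omit [NeZero L] in
/-- ★★ **THE TRANSPORTED STEP AT TWO NEAR SLOW DATA.**  For a kinetic step `W` in the upper hemisphere with `|vecPart(W_e)_c| ≤ τ ≤ 1/30` and slow data `u, u'` with
`|vecPart(u_ku'_k⁻¹)_c| ≤ α ≤ 1/3`, at every plaquette `p`: the anharmonic remainder `vecPart X_p(W;U) − (D_U w)_p` changes by at most `995976·α·τ²` per component between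
`U = constLift u` and `U = constLift u'`, the scalar part `u₀(X_p)` by at most `1014768·α·τ²`, and the covariant curl `(D_U w)_p` by at most `7704·α·τ` (`w = linkVec W`).
[cite: Luscher1983, §3] [cite: BrockerTomDieck1985, I (1.10)] -/
theorem transportStep_constLift_pair_diff (u u' : GaugeConfig 3 1 SU2) (W : GaugeConfig 3 L SU2) {τ α : ℝ} (hτ : τ ≤ 1 / 30) (hα3 : α ≤ 1 / 3)
    (hs : ∀ e : Edge 3 L, 0 ≤ scalarPart (W e)) (hw : ∀ (e : Edge 3 L) (c : Fin 3), |vecPart (W e) c| ≤ τ)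
    (ha : ∀ (k : Fin 3) (c : Fin 3), |vecPart (u (0, k) * (u' (0, k))⁻¹) c| ≤ α) (p : Plaquette 3 L) :
    (∀ c, |(vecPart (transportStep W (constLift L u) p) c - covCurl (constLift L u) (linkVec L W) (p, c)) -
        (vecPart (transportStep W (constLift L u') p) c - covCurl (constLift L u') (linkVec L W) (p, c))| ≤ 995976 * α * τ ^ 2) ∧
      |scalarPart (transportStep W (constLift L u) p) - scalarPart (transportStep W (constLift L u') p)| ≤ 1014768 * α * τ ^ 2 ∧
      (∀ c, |covCurl (constLift L u) (linkVec L W) (p, c) - covCurl (constLift L u') (linkVec L W) (p, c)| ≤ 7704 * α * τ) := by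
  obtain ⟨x, ij⟩ := p
  have hτ0 : 0 ≤ τ := (abs_nonneg _).trans (hw (x, ij.1.1) 0)
  have hα0 : 0 ≤ α := (abs_nonneg _).trans (ha 0 0)
  obtain ⟨hP1, hP2, hP3⟩ := transports_constLift (L := L) u x ij
  obtain ⟨hP1', hP2', hP3'⟩ := transports_constLift (L := L) u' x ij
  set U := constLift L u with hU
  set U' := constLift L u' with hU'
  have hX : transportStep W U (x, ij) = W (x, ij.1.1) * ((ptrans1 U (x, ij) * W (x.shift ij.1.1, ij.1.2) * (ptrans1 U (x, ij))⁻¹) *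
      ((ptrans2 U (x, ij) * W (x.shift ij.1.2, ij.1.1) * (ptrans2 U (x, ij))⁻¹)⁻¹ * (hol U (x, ij) * W (x, ij.1.2) * (hol U (x, ij))⁻¹)⁻¹)) := by
    simp only [transportStep, mul_assoc]
  have hX' : transportStep W U' (x, ij) = W (x, ij.1.1) * ((ptrans1 U' (x, ij) * W (x.shift ij.1.1, ij.1.2) * (ptrans1 U' (x, ij))⁻¹) *
      ((ptrans2 U' (x, ij) * W (x.shift ij.1.2, ij.1.1) * (ptrans2 U' (x, ij))⁻¹)⁻¹ * (hol U' (x, ij) * W (x, ij.1.2) * (hol U' (x, ij))⁻¹)⁻¹)) := by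
    simp only [transportStep, mul_assoc]
  -- the factors at `u'` (primed) and at `u`
  set B₂ := ptrans1 U' (x, ij) * W (x.shift ij.1.1, ij.1.2) * (ptrans1 U' (x, ij))⁻¹ with hB₂
  set B₃ := (ptrans2 U' (x, ij) * W (x.shift ij.1.2, ij.1.1) * (ptrans2 U' (x, ij))⁻¹)⁻¹ with hB₃
  set B₄ := (hol U' (x, ij) * W (x, ij.1.2) * (hol U' (x, ij))⁻¹)⁻¹ with hB₄
  set A₂ := ptrans1 U (x, ij) * W (x.shift ij.1.1, ij.1.2) * (ptrans1 U (x, ij))⁻¹ with hA₂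
  set A₃ := (ptrans2 U (x, ij) * W (x.shift ij.1.2, ij.1.1) * (ptrans2 U (x, ij))⁻¹)⁻¹ with hA₃
  set A₄ := (hol U (x, ij) * W (x, ij.1.2) * (hol U (x, ij))⁻¹)⁻¹ with hA₄
  set A₁ := W (x, ij.1.1) with hA₁
  -- hemisphere and scalar parts
  have h₁ : 0 ≤ scalarPart A₁ := hs _
  have h₂ : 0 ≤ scalarPart A₂ := (conj_factor_bounds _ _ (hs _) (hw _)).1
  have h₃ : 0 ≤ scalarPart A₃ := (conj_inv_factor_bounds _ _ (hs _) (hw _)).1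
  have h₄ : 0 ≤ scalarPart A₄ := (conj_inv_factor_bounds _ _ (hs _) (hw _)).1
  have h₂' : 0 ≤ scalarPart B₂ := (conj_factor_bounds _ _ (hs _) (hw _)).1
  have h₃' : 0 ≤ scalarPart B₃ := (conj_inv_factor_bounds _ _ (hs _) (hw _)).1
  have h₄' : 0 ≤ scalarPart B₄ := (conj_inv_factor_bounds _ _ (hs _) (hw _)).1
  have hs₂ : scalarPart B₂ = scalarPart A₂ := by rw [hB₂, hA₂, scalarPart_conj, scalarPart_conj]
  have hs₃ : scalarPart B₃ = scalarPart A₃ := by rw [hB₃, hA₃, scalarPart_inv, scalarPart_inv, scalarPart_conj, scalarPart_conj]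
  have hs₄ : scalarPart B₄ = scalarPart A₄ := by rw [hB₄, hA₄, scalarPart_inv, scalarPart_inv, scalarPart_conj, scalarPart_conj]
  -- sizes `≤ 3τ`
  have hτ3 : ∀ {e : Edge 3 L} (c : Fin 3), |vecPart (W e) c| ≤ 3 * τ := fun {e} c => (hw e c).trans (by linarith)
  have ha₁ : ∀ c, |vecPart A₁ c| ≤ 3 * τ := fun c => hτ3 c
  have ha₂ : ∀ c, |vecPart A₂ c| ≤ 3 * τ := (conj_factor_bounds _ _ (hs _) (hw _)).2
  have ha₃ : ∀ c, |vecPart A₃ c| ≤ 3 * τ := (conj_inv_factor_bounds _ _ (hs _) (hw _)).2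
  have ha₄ : ∀ c, |vecPart A₄ c| ≤ 3 * τ := (conj_inv_factor_bounds _ _ (hs _) (hw _)).2
  have ha₂' : ∀ c, |vecPart B₂ c| ≤ 3 * τ := (conj_factor_bounds _ _ (hs _) (hw _)).2
  have ha₃' : ∀ c, |vecPart B₃ c| ≤ 3 * τ := (conj_inv_factor_bounds _ _ (hs _) (hw _)).2
  have ha₄' : ∀ c, |vecPart B₄ c| ≤ 3 * τ := (conj_inv_factor_bounds _ _ (hs _) (hw _)).2
  -- displacements `≤ 6264ατ`
  have hδ0 : 0 ≤ 6264 * α * τ := by positivity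
  have hd₁ : ∀ c, |vecPart A₁ c - vecPart A₁ c| ≤ 6264 * α * τ := fun c => by rw [sub_self, abs_zero]; exact hδ0
  have hd₂s : ∀ c, |vecPart B₂ c - vecPart A₂ c| ≤ 36 * α * τ := fun c => by
    rw [hB₂, hA₂, vecPart_conj, vecPart_conj, hP1, hP1', abs_sub_comm, ← Pi.sub_apply]
    exact (transports_constLift_pair_displacement u u' hα3 ha ij.1.1 ij.1.2 (hw (x.shift ij.1.1, ij.1.2)) c).1
  have hd₃s : ∀ c, |vecPart B₃ c - vecPart A₃ c| ≤ 1404 * α * τ := fun c => by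
    rw [hB₃, hA₃, vecPart_conj_inv, vecPart_conj_inv, hP2, hP2']
    have h := (transports_constLift_pair_displacement u u' hα3 ha ij.1.1 ij.1.2 (hw (x.shift ij.1.2, ij.1.1)) c).2.1
    have e : (-(adRot (u' (0, ij.1.1) * u' (0, ij.1.2) * (u' (0, ij.1.1))⁻¹) *ᵥ vecPart (W (x.shift ij.1.2, ij.1.1)))) c -
        (-(adRot (u (0, ij.1.1) * u (0, ij.1.2) * (u (0, ij.1.1))⁻¹) *ᵥ vecPart (W (x.shift ij.1.2, ij.1.1)))) c =
        (adRot (u (0, ij.1.1) * u (0, ij.1.2) * (u (0, ij.1.1))⁻¹) *ᵥ vecPart (W (x.shift ij.1.2, ij.1.1)) -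
          adRot (u' (0, ij.1.1) * u' (0, ij.1.2) * (u' (0, ij.1.1))⁻¹) *ᵥ vecPart (W (x.shift ij.1.2, ij.1.1))) c := by
      simp only [Pi.neg_apply, Pi.sub_apply]; ring
    rw [e]; exact h
  have hd₄ : ∀ c, |vecPart B₄ c - vecPart A₄ c| ≤ 6264 * α * τ := fun c => by
    rw [hB₄, hA₄, vecPart_conj_inv, vecPart_conj_inv, hP3, hP3']
    have h := (transports_constLift_pair_displacement u u' hα3 ha ij.1.1 ij.1.2 (hw (x, ij.1.2)) c).2.2
    have e : (-(adRot (u' (0, ij.1.1) * u' (0, ij.1.2) * (u' (0, ij.1.1))⁻¹ * (u' (0, ij.1.2))⁻¹) *ᵥ vecPart (W (x, ij.1.2)))) c -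
        (-(adRot (u (0, ij.1.1) * u (0, ij.1.2) * (u (0, ij.1.1))⁻¹ * (u (0, ij.1.2))⁻¹) *ᵥ vecPart (W (x, ij.1.2)))) c =
        (adRot (u (0, ij.1.1) * u (0, ij.1.2) * (u (0, ij.1.1))⁻¹ * (u (0, ij.1.2))⁻¹) *ᵥ vecPart (W (x, ij.1.2)) -
          adRot (u' (0, ij.1.1) * u' (0, ij.1.2) * (u' (0, ij.1.1))⁻¹ * (u' (0, ij.1.2))⁻¹) *ᵥ vecPart (W (x, ij.1.2))) c := by
      simp only [Pi.neg_apply, Pi.sub_apply]; ring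
    rw [e]; exact h
  have hατ : 0 ≤ α * τ := mul_nonneg hα0 hτ0
  have hd₂ : ∀ c, |vecPart B₂ c - vecPart A₂ c| ≤ 6264 * α * τ := fun c => (hd₂s c).trans (by nlinarith)
  have hd₃ : ∀ c, |vecPart B₃ c - vecPart A₃ c| ≤ 6264 * α * τ := fun c => (hd₃s c).trans (by nlinarith)
  -- the four-factor lemma with `s = 3τ`, `δ = 6264ατ` (primed quadruple = at `u'`, unprimed = at `u`)
  have hs3 : 3 * τ ≤ 1 / 10 := by linarith
  obtain ⟨R, S⟩ := prod4_second_diff h₁ h₂ h₃ h₄ h₁ h₂' h₃' h₄' rfl hs₂ hs₃ hs₄ hs3 hδ0 ha₁ ha₂ ha₃ ha₄ ha₁ ha₂' ha₃' ha₄' hd₁ hd₂ hd₃ hd₄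
  -- the linear parts are the covariant curls
  have hlin : ∀ c, vecPart A₁ c + vecPart A₂ c + vecPart A₃ c + vecPart A₄ c = covCurl U (linkVec L W) ((x, ij), c) := fun c =>
    sum_vecPart_factors_eq_covCurl W U (x, ij) c
  have hlin' : ∀ c, vecPart A₁ c + vecPart B₂ c + vecPart B₃ c + vecPart B₄ c = covCurl U' (linkVec L W) ((x, ij), c) := fun c =>
    sum_vecPart_factors_eq_covCurl W U' (x, ij) c
  refine ⟨fun c => ?_, ?_, fun c => ?_⟩
  · rw [hX', hX, ← hlin' c, ← hlin c]
    have h := R c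
    have e : (53 : ℝ) * (3 * τ) * (6264 * α * τ) = 995976 * α * τ ^ 2 := by ring
    rw [e] at h
    rw [abs_sub_comm]
    exact h
  · rw [hX', hX]
    have e : (54 : ℝ) * (3 * τ) * (6264 * α * τ) = 1014768 * α * τ ^ 2 := by ring
    rw [e] at S
    rw [abs_sub_comm]
    exact S
  · rw [← hlin' c, ← hlin c]
    have e : vecPart A₁ c + vecPart A₂ c + vecPart A₃ c + vecPart A₄ c - (vecPart A₁ c + vecPart B₂ c + vecPart B₃ c + vecPart B₄ c) =
        -((vecPart B₂ c - vecPart A₂ c) + (vecPart B₃ c - vecPart A₃ c) + (vecPart B₄ c - vecPart A₄ c)) := by ring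
    rw [e, abs_neg]
    have := abs_add_le ((vecPart B₂ c - vecPart A₂ c) + (vecPart B₃ c - vecPart A₃ c)) (vecPart B₄ c - vecPart A₄ c)
    have := abs_add_le (vecPart B₂ c - vecPart A₂ c) (vecPart B₃ c - vecPart A₃ c)
    linarith [hd₂s c, hd₃s c, hd₄ c]

end Summit.QuantumFields.YangMills.Theorems.FemtoTransferGap.RateTube

end
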